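import Mathlib
import HarnessLib

/-!
# Circuit numbers: the SONC and SAGE nonnegativity certificates and their exact check

Topic `Literature/Algebra/Polynomial` (exact certificates of polynomial / signomial nonnegativity
that are *not* sums of squares: sums of nonnegative circuit polynomials (SONC) and sums of
arithmetic-geometric-mean exponentials (SAGE), as used by the exact optimisers `optsonc`,
`optsage`, `intsage` of Magron–Seidler–de Wolff).  The certificate-to-nonnegativity directions are
formalised in full; the converse directions (which need the norm minimiser of Iliman–de Wolff,
resp. convex duality) are recorded as citations only.

## Sources

* [IlimanDewolff2016] S. Iliman, T. de Wolff, *Amoebas, nonnegative polynomials and sums of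
  squares supported on circuits*, Res. Math. Sci. 3 (2016), doi:10.1186/s40687-016-0052-2
  (arXiv:1402.0462).  Circuit number: «For `f ∈ P_Δ^y` we define the circuit number `Θ_f` as
  `Θ_f = ∏_{j=0}^{n} (b_j/λ_j)^{λ_j}`, where the `λ_j` are uniquely given by the convex combination
  `∑ λ_j α(j) = y, λ_j ≥ 0, ∑ λ_j = 1`.»  Main theorem of the Introduction (Theorem 1 of the
  arXiv text; its nonnegativity part is the journal's Theorem 3.8 — the number quoted by
  [MagronSeidlerDewolff2019, Thm. 2.1] — which is Theorem 17 of the arXiv text): «Let `f ∈ P_Δ^y`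
  and `Δ` be an even simplex, i.e., `α(j) ∈ (2ℕ)ⁿ` for all `0 ≤ j ≤ n`. Then the following
  statements are equivalent. (1) `c ∈ [−Θ_f, Θ_f]` for `y ∉ (2ℕ)ⁿ` and `c ≥ −Θ_f` for
  `y ∈ (2ℕ)ⁿ`. (2) `f` is nonnegative.»  Its proof reduces to `x ≥ 0` by the sign symmetry of the
  even outer monomials, passes to `x = e^w` and uses the norm minimiser / weighted AM/GM; the
  worked example following it (after the corollary bounding the real zeros of boundary forms by
  `2ⁿ`) is the Motzkin polynomial, `λ_j = 1/3`, `Θ_f = 3`, `c = −3`.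
* [MagronSeidlerDewolff2019] V. Magron, H. Seidler, T. de Wolff, *Exact optimization via sums of
  nonnegative circuits and arithmetic-geometric-mean-exponentials*, ISSAC 2019, 291–298,
  doi:10.1145/3326229.3326271.  Definition 2 (circuit polynomial `p = ∑_{j=0}^{r} b_{α(j)} x^{α(j)}
  + b_β x^β`, coefficients `b_{α(j)} ∈ ℝ_{>0}`, exponents `α(j) ∈ (2ℤ)ⁿ`, `β = ∑ λ_j α(j)` with
  `λ_j > 0`, `∑ λ_j = 1`), the circuit number `Θ_p = ∏ (b_{α(j)}/λ_j)^{λ_j}`, **Theorem 2.1**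
  ([IlimanDewolff2016], Theorem 3.8): «Let `p` be a circuit polynomial … Then `p` is nonnegative
  if and only if `p` is a sum of monomial squares, or `|b_β| ≤ Θ_p`», Definition 3 (the SONC cone),
  §2.2 («Hence `b_0 − GP_opt` is a lower bound for `p`»), §2.3: the relative entropy
  `D(ν, c) = ∑ ν_j log(ν_j/c_j)`, **Lemma 2.3** (stated from [ChandrasekaranShah2016]): «Let
  `p(x) = ∑_{j=1}^{t} c_j exp(α(j)·x) + β exp(α(0)·x)` with `c_j > 0` … Then `p(x) ≥ 0` for all
  `x ∈ ℝⁿ` if and only if there exists `ν ∈ ℝ_+^t` such that `D(ν, e c) ≤ β` and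
  `∑ α(j) ν_j = (1·ν) α(0)`», Theorem 2.4 (SAGE), and Algorithm 3.1 `optsonc`, whose rounding step
  enforces `X_{β,0} ≥ λ_0 (−b_β ∏ (λ_α/X_{β,α})^{λ_α})^{1/λ_0}`, i.e. the circuit-number inequality
  of each summand, after which «each `p_β` is a nonnegative circuit polynomial. Hence, `C` is a
  lower bound for `p`».
* [ChandrasekaranShah2016] V. Chandrasekaran, P. Shah, *Relative entropy relaxations for signomial
  optimization*, SIAM J. Optim. 26 (2016) 1147–1173, doi:10.1137/140988978, §2.1: an
  AM/GM-exponential `g(x) = β exp(α'x) + ∑ c_j exp([Q'x]_j)`, `c ≥ 0`, is certified nonnegative by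
  any `ν ≥ 0` with `D(ν, e c) − β ≤ 0` and `Qν = (1'ν) α`, via the chain «`∑ c_j exp([Q'x]_j) ≥
  ∏ (c_j exp([Q'x]_j)/(ν_j/1'ν))^{ν_j/1'ν} = ∏ (c_j/(ν_j/1'ν))^{ν_j/1'ν} exp(α'x)`» (weighted
  AM/GM) and «`∏ (c_j/(ν_j/1'ν))^{ν_j/1'ν} = exp(−D(ν/1'ν, c)) ≥ … ≥ −D(ν, e c) ≥ −β`».

## What is formalised

* `circuitNumber b w = ∏_j (b_j/w_j)^{w_j}` and the **weighted AM/GM inequality in circuit form**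
  `circuitNumber_mul_prod_rpow_le`: `Θ · ∏ t_j^{w_j} ≤ ∑ b_j t_j` for `t ≥ 0`, `w ≥ 0`, `∑ w_j = 1`
  (zero weights are allowed; with Lean's conventions `b/0 = 0`, `0^0 = 1` a zero-weight factor is
  `1`, which is the usual "drop the term" convention of the sources).
* The exponential (signomial / AGE) form of the certificate,
  `signomial_nonneg_of_neg_circuitNumber_le`: if `β = ∑ w_j α(j)` then
  `∑ b_j exp(α(j)·x) + c exp(β·x) ≥ 0` on `ℝⁿ` as soon as `c ≥ −Θ`; the relative-entropy bound
  `neg_circuitNumber_le_vecRelEntropy` (`−Θ(c, ν/1'ν) ≤ D(ν, e c)`, the displayed chain of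
  [ChandrasekaranShah2016, §2.1]) and hence the **SAGE certificate**
  `signomial_nonneg_of_vecRelEntropy_le` (the `if` direction of
  [MagronSeidlerDewolff2019, Lemma 2.3]).
* The polynomial form, [MagronSeidlerDewolff2019, Thm. 2.1] / [IlimanDewolff2016, Thm. 3.8],
  direction certificate ⇒ nonnegativity: `circuitNumber_mul_abs_monomial_le`
  (`Θ |x^β| ≤ ∑ b_j x^{α(j)}` for even `α(j)`), `circuitPolynomial_nonneg_of_abs_le`
  (`|c| ≤ Θ ⇒ p ≥ 0`), `circuitPolynomial_nonneg_of_neg_le` (`β` even and `c ≥ −Θ ⇒ p ≥ 0`) and the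
  `MvPolynomial` packaging `eval_circuitPolynomial_nonneg`.
* The lower-bound principle of `optsonc` / `optsage` (`lowerBound_of_sum_decomposition`:
  `f − C = ∑ gₖ` with certified `gₖ ≥ 0` gives `C ≤ f`).
* The **exact arithmetic test** used when the barycentric coordinates are rational,
  `w_j = m_j/M`: `circuitNumber_eq_rpow_inv` (`Θ = (∏ (b_j M/m_j)^{m_j})^{1/M}`),
  `abs_le_circuitNumber_iff` (`|c| ≤ Θ ↔ |c|^M ≤ ∏ (b_j M/m_j)^{m_j}`, a comparison of rationals
  when `b, c ∈ ℚ`) and `neg_circuitNumber_le_iff`; the Motzkin example of [IlimanDewolff2016] is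
  replayed through this test at the end of the file.

Not formalised: the `only if` directions (nonnegative ⇒ `|c| ≤ Θ`, resp. existence of `ν`;
[IlimanDewolff2016, Thm. 3.8 (1) ⇒ (2)] via the norm minimiser, [ChandrasekaranShah2016, Lemma
2.2] via convex duality), the relation between the SONC and SAGE cones, and the algorithms
themselves (the kernel only checks the certificates they output).  The Motzkin polynomial's
nonnegativity is already in the tree (`MotzkinNotSumOfSquares.eval_motzkinXY_nonneg`,
`DsosSdsos.motzkin_nonneg`); the closing `example` merely re-derives it from the circuit number
and is not a named declaration.
-/

namespace Literature.Algebra.Polynomial.CircuitNumberNonnegativity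

open Finset

/-! ### The circuit number and the weighted AM/GM inequality in circuit form -/

section CircuitNumber

variable {ι : Type*} [Fintype ι]

/-- The **circuit number** of a coefficient vector `b` with barycentric coordinates `w`:
`Θ(b, w) = ∏_j (b_j / w_j)^{w_j}` (real powers).  For a circuit polynomial
`p = ∑_j b_j x^{α(j)} + c x^β`, `β = ∑_j w_j α(j)`, this is `Θ_p`.
[cite: IlimanDewolff2016, circuit number Θ_f (Introduction, the display defining Θ_f)]
[cite: MagronSeidlerDewolff2019, Definition 2 and eq. (Θ_p)] -/
noncomputable def circuitNumber (b w : ι → ℝ) : ℝ := ∏ j, (b j / w j) ^ w j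

/-- `Θ(b, w) ≥ 0` for `b, w ≥ 0`. [cite: MagronSeidlerDewolff2019, Definition 2] -/
theorem circuitNumber_nonneg {b w : ι → ℝ} (hb : ∀ j, 0 ≤ b j) (hw : ∀ j, 0 ≤ w j) :
    0 ≤ circuitNumber b w :=
  prod_nonneg fun j _ => Real.rpow_nonneg (div_nonneg (hb j) (hw j)) _

/-- `Θ(b, w) > 0` for `b, w > 0` (the circuit case: positive outer coefficients, inner exponent in
the interior of the simplex). [cite: MagronSeidlerDewolff2019, Definition 2] -/
theorem circuitNumber_pos {b w : ι → ℝ} (hb : ∀ j, 0 < b j) (hw : ∀ j, 0 < w j) :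
    0 < circuitNumber b w :=
  prod_pos fun j _ => Real.rpow_pos_of_pos (div_pos (hb j) (hw j)) _

/-- **Weighted AM/GM in circuit form.**  For weights `w ≥ 0` with `∑ w_j = 1`, coefficients
`b ≥ 0` and values `t ≥ 0`: `Θ(b, w) · ∏_j t_j^{w_j} ≤ ∑_j b_j t_j`.  This is the weighted AM/GM
inequality `∏ z_j^{w_j} ≤ ∑ w_j z_j` applied to `z_j = b_j t_j / w_j` — step (i)–(ii) of
[ChandrasekaranShah2016, §2.1] and the core of the proof of [IlimanDewolff2016, Thm. 3.8].
[cite: ChandrasekaranShah2016, §2.1, inequality (i) and equation (ii)]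
[cite: IlimanDewolff2016, Theorem 3.8 (proof)] -/
theorem circuitNumber_mul_prod_rpow_le {b w : ι → ℝ} (hb : ∀ j, 0 ≤ b j) (hw : ∀ j, 0 ≤ w j)
    (hw1 : ∑ j, w j = 1) {t : ι → ℝ} (ht : ∀ j, 0 ≤ t j) :
    circuitNumber b w * ∏ j, t j ^ w j ≤ ∑ j, b j * t j := by
  have key := Real.geom_mean_le_arith_mean_weighted univ w (fun j => b j * t j / w j)
    (fun j _ => hw j) hw1 (fun j _ => div_nonneg (mul_nonneg (hb j) (ht j)) (hw j))
  calc circuitNumber b w * ∏ j, t j ^ w j = ∏ j, ((b j / w j) ^ w j * t j ^ w j) := by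
        rw [circuitNumber, ← prod_mul_distrib]
    _ = ∏ j, (b j * t j / w j) ^ w j := by
        refine prod_congr rfl fun j _ => ?_
        rw [← Real.mul_rpow (div_nonneg (hb j) (hw j)) (ht j), div_mul_eq_mul_div]
    _ ≤ ∑ j, w j * (b j * t j / w j) := key
    _ ≤ ∑ j, b j * t j := by
        refine sum_le_sum fun j _ => ?_
        rcases (hw j).eq_or_lt with h0 | hpos
        · rw [← h0, zero_mul]; exact mul_nonneg (hb j) (ht j)
        · rw [mul_div_assoc', mul_div_cancel_left₀ _ hpos.ne']

end CircuitNumber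

/-! ### The exponential form: AGE signomials and the SAGE (relative entropy) certificate -/

section Signomial

variable {ι : Type*} [Fintype ι] {n : Type*} [Fintype n]

/-- If `β = ∑_j w_j α(j)` then `β·x = ∑_j w_j (α(j)·x)`.
[cite: ChandrasekaranShah2016, §2.1, equation (ii) (the condition `Qν = (1'ν)α`)] -/
theorem dotProduct_eq_sum_of_barycentre {w : ι → ℝ} {α : ι → n → ℝ} {β : n → ℝ}
    (hβ : ∀ i, β i = ∑ j, w j * α j i) (x : n → ℝ) :
    dotProduct β x = ∑ j, w j * dotProduct (α j) x := by
  simp only [dotProduct, hβ, sum_mul, mul_sum, mul_assoc]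
  exact sum_comm

/-- If `β = ∑_j w_j α(j)` then `exp(β·x) = ∏_j exp(α(j)·x)^{w_j}`: the inner exponential is the
weighted geometric mean of the outer ones.
[cite: ChandrasekaranShah2016, §2.1, equation (ii)] -/
theorem exp_dotProduct_eq_prod_rpow {w : ι → ℝ} {α : ι → n → ℝ} {β : n → ℝ}
    (hβ : ∀ i, β i = ∑ j, w j * α j i) (x : n → ℝ) :
    Real.exp (dotProduct β x) = ∏ j, Real.exp (dotProduct (α j) x) ^ w j := by
  rw [dotProduct_eq_sum_of_barycentre hβ, Real.exp_sum]
  exact prod_congr rfl fun j _ => by rw [mul_comm, Real.exp_mul]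

/-- **AGE certificate, circuit-number form.**  A signomial with one (possibly) negative term,
`g(x) = ∑_j b_j exp(α(j)·x) + c exp(β·x)` with `b ≥ 0`, whose inner exponent is the barycentre
`β = ∑_j w_j α(j)` (`w ≥ 0`, `∑ w_j = 1`), is nonnegative on `ℝⁿ` as soon as `c ≥ −Θ(b, w)`.
This is the exponential-coordinates form (`x = e^w`) in which [IlimanDewolff2016, Thm. 3.8] is
proved, and steps (i)–(ii) of [ChandrasekaranShah2016, §2.1].
[cite: IlimanDewolff2016, Theorem 3.8 (proof, `f(e^w) ≥ 0` iff `c ∈ [−Θ_f, 0]` for `c ≤ 0`)]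
[cite: ChandrasekaranShah2016, §2.1, (i)–(ii)] -/
theorem signomial_nonneg_of_neg_circuitNumber_le {b w : ι → ℝ} (hb : ∀ j, 0 ≤ b j)
    (hw : ∀ j, 0 ≤ w j) (hw1 : ∑ j, w j = 1) {α : ι → n → ℝ} {β : n → ℝ}
    (hβ : ∀ i, β i = ∑ j, w j * α j i) {c : ℝ} (hc : -circuitNumber b w ≤ c) (x : n → ℝ) :
    0 ≤ ∑ j, b j * Real.exp (dotProduct (α j) x) + c * Real.exp (dotProduct β x) := by
  have h1 := circuitNumber_mul_prod_rpow_le hb hw hw1 (t := fun j => Real.exp (dotProduct (α j) x))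
    fun j => (Real.exp_pos _).le
  rw [← exp_dotProduct_eq_prod_rpow hβ x] at h1
  have h2 : -circuitNumber b w * Real.exp (dotProduct β x) ≤ c * Real.exp (dotProduct β x) :=
    mul_le_mul_of_nonneg_right hc (Real.exp_pos _).le
  linarith

/-- The **relative entropy** `D(ν, c) = ∑_j ν_j log(ν_j / c_j)` of two nonnegative vectors
(Lean's `Real.log 0 = 0` realises the convention `0 log 0 = 0`).
[cite: MagronSeidlerDewolff2019, §2.3 (definition of D(ν, c))]
[cite: ChandrasekaranShah2016, §2.1] -/
noncomputable def vecRelEntropy (ν c : ι → ℝ) : ℝ := ∑ j, ν j * Real.log (ν j / c j)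

/-- `D(0, c) = 0`. [cite: ChandrasekaranShah2016, §2.1 (footnote: ν = 0 corresponds to β ≥ 0)] -/
theorem vecRelEntropy_eq_zero_of_eq_zero {ν : ι → ℝ} (hν : ∀ j, ν j = 0) (c : ι → ℝ) :
    vecRelEntropy ν c = 0 := by
  simp [vecRelEntropy, hν]

/-- **The relative-entropy bound on the circuit number** (steps (iii)–(vii) of
[ChandrasekaranShah2016, §2.1]): for `c > 0`, `ν ≥ 0` with `1'ν > 0` and normalised weights
`w = ν / 1'ν`, `−Θ(c, w) ≤ D(ν, e c)`.  Proof: `−D(ν, e c) = 1'ν + 1'ν · log(Θ / 1'ν) ≤ Θ` by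
`log u ≤ u − 1`.
[cite: ChandrasekaranShah2016, §2.1, (iii)–(vii)] -/
theorem neg_circuitNumber_le_vecRelEntropy {c ν : ι → ℝ} (hc : ∀ j, 0 < c j) (hν : ∀ j, 0 ≤ ν j)
    (hs : 0 < ∑ j, ν j) :
    -circuitNumber c (fun j => ν j / ∑ k, ν k) ≤ vecRelEntropy ν (fun j => Real.exp 1 * c j) := by
  set s := ∑ j, ν j with hs_def
  set Θ := circuitNumber c (fun j => ν j / s) with hΘ_def
  -- every factor of `Θ` is positive (a zero weight gives the factor `1`)
  have hfac : ∀ j, 0 < (c j / (ν j / s)) ^ (ν j / s) := by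
    intro j
    rcases (hν j).eq_or_lt with h0 | hpos
    · rw [← h0, zero_div, Real.rpow_zero]; exact one_pos
    · exact Real.rpow_pos_of_pos (div_pos (hc j) (div_pos hpos hs)) _
  have hΘ : 0 < Θ := prod_pos fun j _ => hfac j
  -- the logarithm of each factor
  have hlogfac : ∀ j, Real.log ((c j / (ν j / s)) ^ (ν j / s)) =
      (ν j * Real.log (c j) - ν j * Real.log (ν j) + ν j * Real.log s) / s := by
    intro j
    rcases (hν j).eq_or_lt with h0 | hpos
    · rw [← h0]; simp
    · rw [Real.log_rpow (div_pos (hc j) (div_pos hpos hs)), Real.log_div (hc j).ne'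
        (div_pos hpos hs).ne', Real.log_div hpos.ne' hs.ne']
      field_simp
      ring
  have hlogΘ : s * Real.log Θ = ∑ j, (ν j * Real.log (c j) - ν j * Real.log (ν j)) +
      s * Real.log s := by
    rw [hΘ_def, circuitNumber, Real.log_prod (s := univ) (fun j _ => (hfac j).ne')]
    simp_rw [hlogfac]
    rw [← sum_div, mul_div_cancel₀ _ hs.ne', sum_add_distrib, ← sum_mul, ← hs_def]
  -- the relative entropy, expanded
  have hterm : ∀ j, ν j * Real.log (ν j / (Real.exp 1 * c j)) =
      ν j * Real.log (ν j) - ν j * Real.log (c j) - ν j := by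
    intro j
    rcases (hν j).eq_or_lt with h0 | hpos
    · rw [← h0]; simp
    · rw [Real.log_div hpos.ne' (mul_ne_zero (Real.exp_pos 1).ne' (hc j).ne'),
        Real.log_mul (Real.exp_pos 1).ne' (hc j).ne', Real.log_exp]
      ring
  have hD : vecRelEntropy ν (fun j => Real.exp 1 * c j) =
      ∑ j, (ν j * Real.log (ν j) - ν j * Real.log (c j)) - s := by
    simp only [vecRelEntropy, hterm]
    rw [sum_sub_distrib, ← hs_def]
  -- `log (Θ / s) ≤ Θ / s - 1`
  have hlog : s * Real.log (Θ / s) ≤ Θ - s := by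
    have h := mul_le_mul_of_nonneg_left (Real.log_le_sub_one_of_pos (div_pos hΘ hs)) hs.le
    have h' : s * (Θ / s - 1) = Θ - s := by field_simp
    linarith
  rw [Real.log_div hΘ.ne' hs.ne', mul_sub] at hlog
  have hsum : ∑ j, (ν j * Real.log (ν j) - ν j * Real.log (c j)) =
      -∑ j, (ν j * Real.log (c j) - ν j * Real.log (ν j)) := by
    rw [← sum_neg_distrib]
    exact sum_congr rfl fun j _ => by ring
  linarith

/-- **The SAGE / AGE certificate** (the `if` direction of [MagronSeidlerDewolff2019, Lemma 2.3];
[ChandrasekaranShah2016, §2.1]): let `g(x) = ∑_j c_j exp(α(j)·x) + c₀ exp(β·x)` with `c > 0`.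
If some `ν ≥ 0` satisfies the balance condition `∑_j ν_j α(j) = (1'ν) β` and the relative
entropy inequality `D(ν, e c) ≤ c₀`, then `g ≥ 0` on `ℝⁿ`.  (`ν = 0` is allowed and corresponds to
`c₀ ≥ 0`.)
[cite: MagronSeidlerDewolff2019, Lemma 2.3 (⇐)]
[cite: ChandrasekaranShah2016, §2.1 («the existence of ν … certifies the nonnegativity of g»)] -/
theorem signomial_nonneg_of_vecRelEntropy_le {c ν : ι → ℝ} (hc : ∀ j, 0 < c j) (hν : ∀ j, 0 ≤ ν j)
    {α : ι → n → ℝ} {β : n → ℝ} (hbal : ∀ i, ∑ j, ν j * α j i = (∑ j, ν j) * β i) {c₀ : ℝ}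
    (hD : vecRelEntropy ν (fun j => Real.exp 1 * c j) ≤ c₀) (x : n → ℝ) :
    0 ≤ ∑ j, c j * Real.exp (dotProduct (α j) x) + c₀ * Real.exp (dotProduct β x) := by
  rcases (sum_nonneg fun j (_ : j ∈ univ) => hν j).eq_or_lt with hs0 | hs
  · -- `ν = 0`: the certificate says `0 ≤ c₀`, and every term is nonnegative
    have hν0 : ∀ j, ν j = 0 := fun j =>
      (sum_eq_zero_iff_of_nonneg fun k _ => hν k).mp hs0.symm j (mem_univ j)
    rw [vecRelEntropy_eq_zero_of_eq_zero hν0] at hD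
    exact add_nonneg (sum_nonneg fun j _ => mul_nonneg (hc j).le (Real.exp_pos _).le)
      (mul_nonneg hD (Real.exp_pos _).le)
  · -- `1'ν > 0`: normalise and use the circuit-number form
    set s := ∑ j, ν j with hs_def
    have hw : ∀ j, 0 ≤ ν j / s := fun j => div_nonneg (hν j) hs.le
    have hw1 : ∑ j, ν j / s = 1 := by rw [← sum_div, ← hs_def, div_self hs.ne']
    have hβ : ∀ i, β i = ∑ j, ν j / s * α j i := fun i =>
      calc β i = s * β i / s := by rw [mul_div_cancel_left₀ _ hs.ne']
        _ = (∑ j, ν j * α j i) / s := by rw [hbal i]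
        _ = ∑ j, ν j / s * α j i := by
            rw [sum_div]
            exact sum_congr rfl fun j _ => by ring
    exact signomial_nonneg_of_neg_circuitNumber_le (fun j => (hc j).le) hw hw1 hβ
      ((neg_circuitNumber_le_vecRelEntropy hc hν hs).trans hD) x

/-- **Lower bounds from a decomposition** (the principle behind `optsonc` / `optsage`): if
`f − C` is written as a finite sum of functions each certified nonnegative (nonnegative circuit
polynomials, AGE signomials, …), then `C` is a lower bound of `f`.
[cite: MagronSeidlerDewolff2019, §2.2 («Hence b₀ − GP_opt is a lower bound for p») and
Algorithm 3.1 («each p_β is a nonnegative circuit polynomial. Hence, C is a lower bound for p»)] -/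
theorem lowerBound_of_sum_decomposition {X κ : Type*} (s : Finset κ) (f : X → ℝ) (g : κ → X → ℝ)
    (C : ℝ) (hdec : ∀ x, f x - C = ∑ k ∈ s, g k x) (hg : ∀ k ∈ s, ∀ x, 0 ≤ g k x) (x : X) :
    C ≤ f x := by
  have h : 0 ≤ f x - C := (hdec x).symm ▸ sum_nonneg fun k hk => hg k hk x
  linarith

end Signomial

/-! ### The polynomial form: circuit polynomials with even outer exponents -/

section Polynomial

variable {ι : Type*} [Fintype ι] {n : Type*} [Fintype n]

/-- If `β = ∑_j w_j α(j)` (as real vectors, `w ≥ 0`) and `y ≥ 0`, then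
`y^β = ∏_j (y^{α(j)})^{w_j}`: the inner monomial is the weighted geometric mean of the outer ones.
[cite: IlimanDewolff2016, Theorem 3.8 (proof: passage to `x = e^w`)]
[cite: MagronSeidlerDewolff2019, Definition 2 (C2)] -/
theorem prod_pow_eq_prod_rpow_of_barycentre {w : ι → ℝ} (hw : ∀ j, 0 ≤ w j) {a : ι → n → ℕ}
    {β : n → ℕ} (hβ : ∀ i, (β i : ℝ) = ∑ j, w j * a j i) {y : n → ℝ} (hy : ∀ i, 0 ≤ y i) :
    ∏ i, y i ^ β i = ∏ j, (∏ i, y i ^ a j i) ^ w j := by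
  calc ∏ i, y i ^ β i = ∏ i, y i ^ (∑ j, w j * (a j i : ℝ)) :=
        prod_congr rfl fun i _ => by rw [← hβ i, Real.rpow_natCast]
    _ = ∏ i, ∏ j, y i ^ (w j * (a j i : ℝ)) := prod_congr rfl fun i _ =>
        Real.rpow_sum_of_nonneg (hy i) fun j _ => mul_nonneg (hw j) (Nat.cast_nonneg _)
    _ = ∏ j, ∏ i, y i ^ (w j * (a j i : ℝ)) := prod_comm
    _ = ∏ j, ∏ i, (y i ^ a j i) ^ w j := prod_congr rfl fun j _ => prod_congr rfl fun i _ => by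
        rw [mul_comm, Real.rpow_mul (hy i), Real.rpow_natCast]
    _ = ∏ j, (∏ i, y i ^ a j i) ^ w j := prod_congr rfl fun j _ =>
        Real.finsetProd_rpow univ (fun i => y i ^ a j i) (fun i _ => pow_nonneg (hy i) _) (w j)

/-- **The circuit-number bound for the inner monomial.**  For a circuit polynomial with even
outer exponents `α(j) ∈ (2ℕ)ⁿ`, nonnegative outer coefficients `b_j` and inner exponent
`β = ∑_j w_j α(j)`: `Θ(b, w) · |x^β| ≤ ∑_j b_j x^{α(j)}` for every `x ∈ ℝⁿ`.
[cite: IlimanDewolff2016, Theorem 3.8 (proof)] [cite: MagronSeidlerDewolff2019, Theorem 2.1] -/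
theorem circuitNumber_mul_abs_monomial_le {b w : ι → ℝ} (hb : ∀ j, 0 ≤ b j) (hw : ∀ j, 0 ≤ w j)
    (hw1 : ∑ j, w j = 1) {a : ι → n → ℕ} (ha : ∀ j i, Even (a j i)) {β : n → ℕ}
    (hβ : ∀ i, (β i : ℝ) = ∑ j, w j * a j i) (x : n → ℝ) :
    circuitNumber b w * |∏ i, x i ^ β i| ≤ ∑ j, b j * ∏ i, x i ^ a j i := by
  have hα : ∀ j, ∏ i, x i ^ a j i = ∏ i, |x i| ^ a j i := fun j =>
    prod_congr rfl fun i _ => ((ha j i).pow_abs (x i)).symm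
  have hβ' : |∏ i, x i ^ β i| = ∏ i, |x i| ^ β i := by
    rw [Finset.abs_prod]
    exact prod_congr rfl fun i _ => abs_pow (x i) (β i)
  rw [hβ', prod_pow_eq_prod_rpow_of_barycentre hw hβ fun i => abs_nonneg (x i)]
  simp_rw [hα]
  exact circuitNumber_mul_prod_rpow_le hb hw hw1 fun j =>
    prod_nonneg fun i _ => pow_nonneg (abs_nonneg _) _

/-- **SONC certificate, general inner exponent** ([MagronSeidlerDewolff2019, Thm. 2.1] /
[IlimanDewolff2016, Thm. 3.8], direction certificate ⇒ nonnegativity): a circuit polynomial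
`p = ∑_j b_j x^{α(j)} + c x^β` with `α(j)` even, `b ≥ 0`, `β = ∑ w_j α(j)` and `|c| ≤ Θ_p` is
nonnegative on `ℝⁿ`.
[cite: MagronSeidlerDewolff2019, Theorem 2.1] [cite: IlimanDewolff2016, Theorem 3.8, (2) ⇒ (1)] -/
theorem circuitPolynomial_nonneg_of_abs_le {b w : ι → ℝ} (hb : ∀ j, 0 ≤ b j) (hw : ∀ j, 0 ≤ w j)
    (hw1 : ∑ j, w j = 1) {a : ι → n → ℕ} (ha : ∀ j i, Even (a j i)) {β : n → ℕ}
    (hβ : ∀ i, (β i : ℝ) = ∑ j, w j * a j i) {c : ℝ} (hc : |c| ≤ circuitNumber b w)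
    (x : n → ℝ) : 0 ≤ ∑ j, b j * ∏ i, x i ^ a j i + c * ∏ i, x i ^ β i := by
  have h1 := circuitNumber_mul_abs_monomial_le hb hw hw1 ha hβ x
  have h2 : -(c * ∏ i, x i ^ β i) ≤ |c| * |∏ i, x i ^ β i| := by
    rw [← abs_mul]; exact neg_le_abs _
  have h3 : |c| * |∏ i, x i ^ β i| ≤ circuitNumber b w * |∏ i, x i ^ β i| :=
    mul_le_mul_of_nonneg_right hc (abs_nonneg _)
  linarith

/-- **SONC certificate, even inner exponent**: if moreover `β ∈ (2ℕ)ⁿ`, the one-sided condition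
`c ≥ −Θ_p` suffices (for `c ≥ 0` the polynomial is a sum of monomial squares).
[cite: IlimanDewolff2016, Theorem 3.8, (2) ⇒ (1), case `y ∈ (2ℕ)ⁿ`]
[cite: MagronSeidlerDewolff2019, Theorem 2.1] -/
theorem circuitPolynomial_nonneg_of_neg_le {b w : ι → ℝ} (hb : ∀ j, 0 ≤ b j) (hw : ∀ j, 0 ≤ w j)
    (hw1 : ∑ j, w j = 1) {a : ι → n → ℕ} (ha : ∀ j i, Even (a j i)) {β : n → ℕ}
    (hβ : ∀ i, (β i : ℝ) = ∑ j, w j * a j i) (hβe : ∀ i, Even (β i)) {c : ℝ}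
    (hc : -circuitNumber b w ≤ c) (x : n → ℝ) :
    0 ≤ ∑ j, b j * ∏ i, x i ^ a j i + c * ∏ i, x i ^ β i := by
  have h1 := circuitNumber_mul_abs_monomial_le hb hw hw1 ha hβ x
  have h0 : 0 ≤ ∏ i, x i ^ β i := prod_nonneg fun i _ => (hβe i).pow_nonneg _
  rw [abs_of_nonneg h0] at h1
  have h2 : -circuitNumber b w * ∏ i, x i ^ β i ≤ c * ∏ i, x i ^ β i :=
    mul_le_mul_of_nonneg_right hc h0
  linarith

/-- The same two certificates for the `MvPolynomial` `p = ∑_j b_j X^{α(j)} + c X^β`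
(`α(j), β : n →₀ ℕ`): under either `|c| ≤ Θ_p`, or `β` even and `c ≥ −Θ_p`, `eval x p ≥ 0` for
all `x : n → ℝ`.
[cite: MagronSeidlerDewolff2019, Theorem 2.1] [cite: IlimanDewolff2016, Theorem 3.8, (2) ⇒ (1)] -/
theorem eval_circuitPolynomial_nonneg {b w : ι → ℝ} (hb : ∀ j, 0 ≤ b j) (hw : ∀ j, 0 ≤ w j)
    (hw1 : ∑ j, w j = 1) {a : ι → n →₀ ℕ} (ha : ∀ j i, Even (a j i)) {β : n →₀ ℕ}
    (hβ : ∀ i, (β i : ℝ) = ∑ j, w j * a j i) {c : ℝ}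
    (hc : |c| ≤ circuitNumber b w ∨ ((∀ i, Even (β i)) ∧ -circuitNumber b w ≤ c)) (x : n → ℝ) :
    0 ≤ MvPolynomial.eval x
      (∑ j, MvPolynomial.monomial (a j) (b j) + MvPolynomial.monomial β c) := by
  have hmon : ∀ (s : n →₀ ℕ) (r : ℝ),
      MvPolynomial.eval x (MvPolynomial.monomial s r) = r * ∏ i, x i ^ s i := fun s r => by
    rw [MvPolynomial.eval_monomial, Finsupp.prod_fintype _ _ fun i => pow_zero _]
  rw [map_add, map_sum]
  simp_rw [hmon]
  rcases hc with hc | ⟨hβe, hc⟩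
  · exact circuitPolynomial_nonneg_of_abs_le hb hw hw1 (a := fun j i => a j i) ha hβ hc x
  · exact circuitPolynomial_nonneg_of_neg_le hb hw hw1 (a := fun j i => a j i) ha hβ hβe hc x

end Polynomial

/-! ### Exact arithmetic: checking `|c| ≤ Θ` with rational barycentric coordinates -/

section ExactCheck

variable {ι : Type*} [Fintype ι]

/-- With rational barycentric coordinates `w_j = m_j / M` (`M ≠ 0`), the circuit number is an
`M`-th root: `Θ(b, m/M) = (∏_j (b_j M / m_j)^{m_j})^{1/M}` (a coordinate `m_j = 0` contributes the
factor `1` on both sides).  This is the quantity whose `λ_0`-th root `optsonc` rounds up.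
[cite: MagronSeidlerDewolff2019, Algorithm 3.1 (lines 7–8, the coefficient
`λ_0 (−b_β ∏ (λ_α/X_{β,α})^{λ_α})^{1/λ_0}`) and §3.1] -/
theorem circuitNumber_eq_rpow_inv {b : ι → ℝ} (hb : ∀ j, 0 ≤ b j) (m : ι → ℕ) {M : ℕ}
    (hM : M ≠ 0) :
    circuitNumber b (fun j => (m j : ℝ) / M) = (∏ j, (b j * M / m j) ^ m j) ^ (M : ℝ)⁻¹ := by
  have hz : ∀ j, 0 ≤ b j * M / m j := fun j =>
    div_nonneg (mul_nonneg (hb j) (Nat.cast_nonneg _)) (Nat.cast_nonneg _)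
  have _hM' : (0 : ℝ) < M := by exact_mod_cast Nat.pos_of_ne_zero hM
  simp only [circuitNumber]
  rw [← Real.finsetProd_rpow univ _ (fun j _ => pow_nonneg (hz j) _)]
  refine prod_congr rfl fun j _ => ?_
  rw [div_div_eq_mul_div, div_eq_mul_inv (m j : ℝ) (M : ℝ), Real.rpow_mul (hz j),
    Real.rpow_natCast]

/-- **Exact test of the circuit condition.**  With `w_j = m_j / M`, `M ≠ 0`, `b ≥ 0`:
`|c| ≤ Θ(b, w) ↔ |c|^M ≤ ∏_j (b_j M / m_j)^{m_j}` — for rational data a comparison of two rational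
numbers, which is how a SONC certificate is verified in exact arithmetic («certifying the
nonnegativity … is done by verifying an arithmetic-geometric-mean inequality»).
[cite: MagronSeidlerDewolff2019, §2.3 and Algorithm 3.1 (rounding step, validity of X_{β,0})] -/
theorem abs_le_circuitNumber_iff {b : ι → ℝ} (hb : ∀ j, 0 ≤ b j) (m : ι → ℕ) {M : ℕ} (hM : M ≠ 0)
    (c : ℝ) :
    |c| ≤ circuitNumber b (fun j => (m j : ℝ) / M) ↔ |c| ^ M ≤ ∏ j, (b j * M / m j) ^ m j := by
  have hZ : 0 ≤ ∏ j, (b j * M / m j) ^ m j := prod_nonneg fun j _ =>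
    pow_nonneg (div_nonneg (mul_nonneg (hb j) (Nat.cast_nonneg _)) (Nat.cast_nonneg _)) _
  rw [circuitNumber_eq_rpow_inv hb m hM]
  constructor
  · intro h
    calc |c| ^ M ≤ ((∏ j, (b j * M / m j) ^ m j) ^ (M : ℝ)⁻¹) ^ M :=
          pow_le_pow_left₀ (abs_nonneg c) h M
      _ = ∏ j, (b j * M / m j) ^ m j := Real.rpow_inv_natCast_pow hZ hM
  · intro h
    calc |c| = (|c| ^ M) ^ (M : ℝ)⁻¹ := (Real.pow_rpow_inv_natCast (abs_nonneg c) hM).symm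
      _ ≤ (∏ j, (b j * M / m j) ^ m j) ^ (M : ℝ)⁻¹ :=
          Real.rpow_le_rpow (pow_nonneg (abs_nonneg c) M) h (inv_nonneg.mpr (Nat.cast_nonneg M))

/-- The one-sided (even inner exponent) test:
`−Θ(b, w) ≤ c ↔ (0 ≤ c ∨ |c|^M ≤ ∏ (b_j M/m_j)^{m_j})`.
[cite: MagronSeidlerDewolff2019, Theorem 2.1 and Algorithm 3.1 (rounding step)]
[cite: IlimanDewolff2016, Theorem 3.8 (case `y ∈ (2ℕ)ⁿ`)] -/
theorem neg_circuitNumber_le_iff {b : ι → ℝ} (hb : ∀ j, 0 ≤ b j) (m : ι → ℕ) {M : ℕ} (hM : M ≠ 0)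
    (c : ℝ) :
    -circuitNumber b (fun j => (m j : ℝ) / M) ≤ c ↔
      0 ≤ c ∨ |c| ^ M ≤ ∏ j, (b j * M / m j) ^ m j := by
  rw [← abs_le_circuitNumber_iff hb m hM c]
  have hΘ : 0 ≤ circuitNumber b (fun j => (m j : ℝ) / M) :=
    circuitNumber_nonneg hb fun j => div_nonneg (Nat.cast_nonneg _) (Nat.cast_nonneg _)
  constructor
  · intro h
    by_cases h0 : 0 ≤ c
    · exact Or.inl h0
    · right
      rw [abs_of_neg (lt_of_not_ge h0)]
      linarith
  · rintro (h0 | h)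
    · linarith
    · linarith [neg_abs_le c]

end ExactCheck

/-! ### Worked example: the Motzkin polynomial ([IlimanDewolff2016], the example following Thm. 3.8)

`M(u, v) = 1 + u²v⁴ + u⁴v² − 3u²v²` is the circuit polynomial with outer exponents
`(0,0), (2,4), (4,2)`, coefficients `1, 1, 1`, inner exponent `(2,2) = ⅓(0,0) + ⅓(2,4) + ⅓(4,2)`
and inner coefficient `c = −3`; the exact test reads `|−3|³ = 27 ≤ (1·3/1)¹·(1·3/1)¹·(1·3/1)¹ = 27`,
so `c ≥ −Θ = −3` and `M ≥ 0`.  (Nonnegativity of the Motzkin polynomial is the tree's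
`MotzkinNotSumOfSquares.eval_motzkinXY_nonneg`; the `example` below only replays it through the
circuit number and introduces no declaration.) -/

example (u v : ℝ) : 0 ≤ 1 + u ^ 2 * v ^ 4 + u ^ 4 * v ^ 2 - 3 * (u ^ 2 * v ^ 2) := by
  have hb : ∀ j : Fin 3, (0 : ℝ) ≤ (fun _ : Fin 3 => (1 : ℝ)) j := fun _ => zero_le_one
  have hM : (3 : ℕ) ≠ 0 := by decide
  -- the exact test `|−3|³ ≤ (1·3/1)¹·(1·3/1)¹·(1·3/1)¹`
  have hc : -circuitNumber (fun _ : Fin 3 => (1 : ℝ))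
      (fun _ : Fin 3 => ((1 : ℕ) : ℝ) / ((3 : ℕ) : ℝ)) ≤ -3 := by
    rw [neg_circuitNumber_le_iff hb (fun _ => 1) hM]
    right
    norm_num [Finset.prod_const, Finset.card_univ, Fintype.card_fin]
  have hw : ∀ j : Fin 3, (0 : ℝ) ≤ (fun _ : Fin 3 => ((1 : ℕ) : ℝ) / ((3 : ℕ) : ℝ)) j :=
    fun _ => by norm_num
  have hw1 : ∑ j : Fin 3, (fun _ : Fin 3 => ((1 : ℕ) : ℝ) / ((3 : ℕ) : ℝ)) j = 1 := by norm_num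
  have ha : ∀ (j : Fin 3) (i : Fin 2),
      Even ((![![0, 0], ![2, 4], ![4, 2]] : Fin 3 → Fin 2 → ℕ) j i) := by decide
  have hβe : ∀ i : Fin 2, Even ((![2, 2] : Fin 2 → ℕ) i) := by decide
  -- the barycentre relation `3·(2,2) = (0,0) + (2,4) + (4,2)`, checked over `ℕ`
  have hnat : ∀ i : Fin 2, 3 * (![2, 2] : Fin 2 → ℕ) i =
      ∑ j : Fin 3, (![![0, 0], ![2, 4], ![4, 2]] : Fin 3 → Fin 2 → ℕ) j i := by decide
  have hβ : ∀ i : Fin 2, (((![2, 2] : Fin 2 → ℕ) i : ℕ) : ℝ) =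
      ∑ j : Fin 3, (fun _ : Fin 3 => ((1 : ℕ) : ℝ) / ((3 : ℕ) : ℝ)) j *
        (((![![0, 0], ![2, 4], ![4, 2]] : Fin 3 → Fin 2 → ℕ) j i : ℕ) : ℝ) := by
    intro i
    have h := congrArg (Nat.cast : ℕ → ℝ) (hnat i)
    push_cast at h
    simp only [← Finset.mul_sum]
    rw [← h]
    ring
  have h := circuitPolynomial_nonneg_of_neg_le hb hw hw1 ha hβ hβe hc ![u, v]
  simp only [Fin.sum_univ_three, Fin.prod_univ_two, Matrix.cons_val_zero, Matrix.cons_val_one,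
    Matrix.cons_val] at h
  norm_num at h
  linarith

end Literature.Algebra.Polynomial.CircuitNumberNonnegativity
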